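import Summits.ValiantsHypothesis.ValiantsHypothesis.Theorems.SymPencilPerFourPairingHyperplane

/-!
# Route `SymPencil` — three-dimensional spaces with vanishing `2 × 2` subpermanents, I: three
# pairwise perm-orthogonal vectors, and a rank-`3` row (primitives for `SymPencilPerFourBlocksThree`;
# `--supports` stmt-ValiantsHypothesis-5674 `SdcSuperquadratic`)

**Theorem** (`row_or_col_of_perm_two_blocks_three`).  Over a field of characteristic `0`, a
`3`-dimensional linear space `W` of `4 × 4` matrices on which all `2 × 2` subpermanents vanish is
contained in a single row or in a single column.  (Dimension `4`:
`SymPencilPerFourBlocksEq.row_or_col_of_perm_two_blocks`, val-width-5676-p2 g3; dimension `≤ 4`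
always: `SymPencilPerFourBlocks.finrank_le_four_of_perm_two_blocks`, val-width-5674-p2.  In
dimension `2` the statement fails: `span{E₀₀ + E₀₁, E₁₀ - E₁₁}`.)

Proof.  If some row `q` maps `W` onto a `3`-dimensional space (`rows_eq_zero_of_row_three`): for
rows `q, p` and distinct columns `j, l, m` the three subpermanent relations give
`x_{ql} x_{qm} x_{pj} = 0` pointwise on `W`; a product of linear forms vanishing on `W` has a
factor vanishing on `W` (`SymPencilPerFourPairingHyperplane.exists_forall_eq_zero_of_prod_eq_zero`),
and at most one coordinate of row `q` can vanish identically (rank `3`), so `x_{pj} ≡ 0`: `W` lies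
in row `q`.  Otherwise run the row flag of `finrank_le_four_of_perm_two_blocks`: the level
dimensions are `≤ 1` (a level of dimension `≥ 2` forces all others to be `0`, total `< 3`, or is a
rank-`3` row), so three levels carry non-zero vectors, pairwise perm-orthogonal across levels; three
pairwise perm-orthogonal non-zero vectors of `K⁴` have a common one-point support `{c}`
(`common_support_of_perm_orth_three`), and then each level representative, hence `W`, lies in
column `c`.

Use: in the two-sided kernel package a kernel `V` of dimension `3` with defect `≤ 3` has all
`2 × 2` subpermanents vanishing (`SymPencilPerFourHessianBlocks.perm_two_blocks_of_sum_sq_swap`), so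
it lies in a row or a column and `per_4 (u + s y)` is affine along it: the cells `(13, 3, 0/1)` at
`m = 27, 28` are invisible to every second-moment reading, exactly like `(12, 4, 0)` at `m = 25`
(`Cruxes/SdcSuperquadratic/NEXT-RUNG-25.md`).  Honest framing: linear algebra; the tree's window
is `25 ≤ sdc(per₄) ≤ 29`; the crux `SdcSuperquadratic` and `VP ≠ VNP` are untouched.  No
definitions, no named facts. [folklore]
-/

noncomputable section

-- single-conjunct layout: Sub = Summit, duplicated namespace component intended
set_option linter.dupNamespace false

namespace Summit.ValiantsHypothesis.ValiantsHypothesis.Theorems.SymPencilPerFourPermOrthThree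

open Matrix Finset Module
open Literature.Computability.AlgebraicComplexity.AlperBogartVelasco
open Summit.ValiantsHypothesis.ValiantsHypothesis.Theorems.SymPencilPerFourPairingHyperplane

variable {K : Type*} [Field K]

/-- **Three pairwise perm-orthogonal non-zero vectors of `K⁴` have a common one-point support.**
(Two do not suffice: `(1,1,0,0)` and `(1,-1,0,0)`.) [folklore] -/
theorem common_support_of_perm_orth_three [CharZero K] (u v w : Fin 4 → K) (hu : u ≠ 0)
    (hv : v ≠ 0) (hw : w ≠ 0)
    (o1 : ∀ l l' : Fin 4, l ≠ l' → u l * v l' + u l' * v l = 0)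
    (o2 : ∀ l l' : Fin 4, l ≠ l' → u l * w l' + u l' * w l = 0)
    (o3 : ∀ l l' : Fin 4, l ≠ l' → v l * w l' + v l' * w l = 0) :
    ∃ c : Fin 4, ∀ l, l ≠ c → u l = 0 ∧ v l = 0 ∧ w l = 0 := by
  obtain ⟨c, hc⟩ : ∃ c, u c ≠ 0 := Function.ne_iff.mp hu
  -- `u` is supported on `{c}`
  have hul : ∀ l, l ≠ c → u l = 0 := by
    intro l hlc
    by_contra hul
    -- third and fourth index
    obtain ⟨j, m, hjm, hjc, hjl, hmc, hml⟩ : ∃ j m : Fin 4, j ≠ m ∧ j ≠ c ∧ j ≠ l ∧ m ≠ c ∧ m ≠ l := by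
      have key : ∀ c l : Fin 4, l ≠ c → ∃ j m : Fin 4, j ≠ m ∧ j ≠ c ∧ j ≠ l ∧ m ≠ c ∧ m ≠ l := by
        decide
      exact key c l hlc
    -- `v` and `w` vanish off `{c, l}`: `2 u_c u_l v_j = 0`
    have hv0 : ∀ j', j' ≠ c → j' ≠ l → v j' = 0 := by
      intro j' hj'c hj'l
      have e1 := o1 j' c hj'c
      have e2 := o1 j' l hj'l
      have e3 := o1 c l hlc.symm
      have h2 : (2 : K) * (u c * u l) * v j' = 0 := by
        linear_combination u c * e2 + u l * e1 - u j' * e3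
      rcases mul_eq_zero.1 h2 with h | h
      · rcases mul_eq_zero.1 h with h | h
        · exact absurd h two_ne_zero
        · exact absurd h (mul_ne_zero hc hul)
      · exact h
    have hw0 : ∀ j', j' ≠ c → j' ≠ l → w j' = 0 := by
      intro j' hj'c hj'l
      have e1 := o2 j' c hj'c
      have e2 := o2 j' l hj'l
      have e3 := o2 c l hlc.symm
      have h2 : (2 : K) * (u c * u l) * w j' = 0 := by
        linear_combination u c * e2 + u l * e1 - u j' * e3
      rcases mul_eq_zero.1 h2 with h | h
      · rcases mul_eq_zero.1 h with h | h
        · exact absurd h two_ne_zero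
        · exact absurd h (mul_ne_zero hc hul)
      · exact h
    -- on `{c, l}`: `v`, `w` are forced to be proportional to `(u_c, -u_l)`-type vectors and then
    -- `2 u_l v_c w_c = 0`
    have f1 := o1 c l hlc.symm   -- u c * v l + u l * v c = 0
    have f2 := o2 c l hlc.symm   -- u c * w l + u l * w c = 0
    have f3 := o3 c l hlc.symm   -- v c * w l + v l * w c = 0
    have h2 : (2 : K) * u l * (v c * w c) = 0 := by
      have : u c * (v c * w l + v l * w c) = 0 := by rw [f3, mul_zero]
      linear_combination -this + v c * f2 + w c * f1
    have hvw : v c * w c = 0 := by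
      rcases mul_eq_zero.1 h2 with h | h
      · rcases mul_eq_zero.1 h with h | h
        · exact absurd h two_ne_zero
        · exact absurd h hul
      · exact h
    rcases mul_eq_zero.1 hvw with hvc | hwc
    · -- then `v l = 0` too and `v = 0`
      have hvl : v l = 0 := by
        have h' := f1
        rw [hvc, mul_zero, add_zero] at h'
        exact (mul_eq_zero.1 h').resolve_left hc
      apply hv
      funext j'
      by_cases h1 : j' = c
      · rw [h1]; exact hvc
      by_cases h2' : j' = l
      · rw [h2']; exact hvl
      exact hv0 j' h1 h2'
    · have hwl : w l = 0 := by
        have h' := f2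
        rw [hwc, mul_zero, add_zero] at h'
        exact (mul_eq_zero.1 h').resolve_left hc
      apply hw
      funext j'
      by_cases h1 : j' = c
      · rw [h1]; exact hwc
      by_cases h2' : j' = l
      · rw [h2']; exact hwl
      exact hw0 j' h1 h2'
  refine ⟨c, fun l hlc => ⟨hul l hlc, ?_, ?_⟩⟩
  · have e := o1 c l hlc.symm
    rw [hul l hlc, zero_mul, add_zero] at e
    exact (mul_eq_zero.1 e).resolve_left hc
  · have e := o2 c l hlc.symm
    rw [hul l hlc, zero_mul, add_zero] at e
    exact (mul_eq_zero.1 e).resolve_left hc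

/-- **A row of rank `3` absorbs `W`.**  If all `2 × 2` subpermanents vanish on `W` and row `q`
maps `W` onto a space of dimension `≥ 3`, then every other row vanishes on `W`. [folklore] -/
theorem rows_eq_zero_of_row_three [CharZero K] (W : Submodule K (Fin 4 × Fin 4 → K))
    (hB : ∀ y ∈ W, ∀ i k j l : Fin 4, i ≠ k → j ≠ l →
      y (i, j) * y (k, l) + y (i, l) * y (k, j) = 0)
    (q : Fin 4) (h3 : 3 ≤ finrank K ↥(W.map (LinearMap.funLeft K K fun j : Fin 4 => (q, j)))) :
    ∀ x ∈ W, ∀ p : Fin 4, p ≠ q → ∀ j, x (p, j) = 0 := by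
  classical
  set ρ : (Fin 4 × Fin 4 → K) →ₗ[K] (Fin 4 → K) := LinearMap.funLeft K K fun j : Fin 4 => (q, j)
    with hρdef
  have hρ : ∀ x j, ρ x j = x (q, j) := fun _ _ => rfl
  -- at most one coordinate of row `q` vanishes identically on `W`
  have hone : ∀ l m : Fin 4, l ≠ m → (∀ x ∈ W, x (q, l) = 0) → (∀ x ∈ W, x (q, m) = 0) → False := by
    intro l m hlm hl hm
    obtain ⟨j₁, j₂, -, hj1l, hj1m, hj2l, hj2m, hcov⟩ :
        ∃ j₁ j₂ : Fin 4, j₁ ≠ j₂ ∧ j₁ ≠ l ∧ j₁ ≠ m ∧ j₂ ≠ l ∧ j₂ ≠ m ∧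
          ∀ j : Fin 4, j = l ∨ j = m ∨ j = j₁ ∨ j = j₂ := by
      have key : ∀ l m : Fin 4, l ≠ m → ∃ j₁ j₂ : Fin 4, j₁ ≠ j₂ ∧ j₁ ≠ l ∧ j₁ ≠ m ∧ j₂ ≠ l ∧
          j₂ ≠ m ∧ ∀ j : Fin 4, j = l ∨ j = m ∨ j = j₁ ∨ j = j₂ := by decide
      exact key l m hlm
    set T : Finset (Fin 4) := {j₁, j₂} with hTdef
    set C : Submodule K (Fin 4 → K) :=
      Submodule.span K ↑(T.image fun j => (Pi.single j (1 : K) : Fin 4 → K)) with hCdef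
    have hCle : finrank K C ≤ 2 := by
      rw [hCdef]
      refine (finrank_span_finset_le_card _).trans (Finset.card_image_le.trans ?_)
      rw [hTdef]; exact Finset.card_le_two
    have hWC : W.map ρ ≤ C := by
      rintro _ ⟨x, hx, rfl⟩
      have hdecomp : ρ x = ∑ j ∈ T, ρ x j • (Pi.single j (1 : K) : Fin 4 → K) :=
        calc ρ x = ∑ j, (Pi.single j (ρ x j) : Fin 4 → K) := (Finset.univ_sum_single (ρ x)).symm
          _ = ∑ j ∈ T, (Pi.single j (ρ x j) : Fin 4 → K) := by
            symm
            refine Finset.sum_subset (Finset.subset_univ T) fun j _ hj => ?_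
            have hj0 : ρ x j = 0 := by
              rw [hρ]
              rcases hcov j with h | h | h | h
              · rw [h]; exact hl x hx
              · rw [h]; exact hm x hx
              · exact absurd (by rw [h, hTdef]; simp) hj
              · exact absurd (by rw [h, hTdef]; simp) hj
            rw [hj0, Pi.single_zero]
          _ = ∑ j ∈ T, ρ x j • (Pi.single j (1 : K) : Fin 4 → K) :=
            Finset.sum_congr rfl fun j _ => by
              ext j'
              by_cases hj : j' = j
              · subst hj; simp
              · simp [hj]
      rw [hdecomp, hCdef]
      exact Submodule.sum_mem _ fun j hj => Submodule.smul_mem _ _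
        (Submodule.subset_span (Finset.mem_coe.2 (Finset.mem_image_of_mem _ hj)))
    have := (Submodule.finrank_mono hWC).trans hCle
    omega
  -- the pointwise identity `x_{ql} x_{qm} x_{pj} = 0`
  have hprod : ∀ p : Fin 4, p ≠ q → ∀ j l m : Fin 4, j ≠ l → j ≠ m → l ≠ m →
      ∀ x ∈ W, x (q, l) * x (q, m) * x (p, j) = 0 := by
    intro p hpq j l m hjl hjm hlm x hx
    have e1 := hB x hx q p j l hpq.symm hjl
    have e2 := hB x hx q p j m hpq.symm hjm
    have e3 := hB x hx q p l m hpq.symm hlm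
    have h2 : (2 : K) * (x (q, l) * x (q, m) * x (p, j)) = 0 := by
      linear_combination x (q, l) * e2 + x (q, m) * e1 - x (q, j) * e3
    exact (mul_eq_zero.1 h2).resolve_left two_ne_zero
  -- a product of three linear forms vanishing on `W` has a factor vanishing on `W`
  have hfactor : ∀ p : Fin 4, p ≠ q → ∀ j l m : Fin 4, j ≠ l → j ≠ m → l ≠ m →
      (∀ x ∈ W, x (q, l) = 0) ∨ (∀ x ∈ W, x (q, m) = 0) ∨ (∀ x ∈ W, x (p, j) = 0) := by
    intro p hpq j l m hjl hjm hlm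
    let f : Fin 3 → ((Fin 4 × Fin 4 → K) →ₗ[K] K) :=
      ![LinearMap.proj (q, l), LinearMap.proj (q, m), LinearMap.proj (p, j)]
    have hf : ∀ x ∈ W, ∏ i ∈ (Finset.univ : Finset (Fin 3)), f i x = 0 := by
      intro x hx
      rw [Fin.prod_univ_three]
      exact hprod p hpq j l m hjl hjm hlm x hx
    obtain ⟨i, -, hi⟩ := exists_forall_eq_zero_of_prod_eq_zero W f Finset.univ hf
    fin_cases i
    · exact Or.inl fun x hx => hi x hx
    · exact Or.inr (Or.inl fun x hx => hi x hx)
    · exact Or.inr (Or.inr fun x hx => hi x hx)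
  intro x hx p hpq j
  -- the three other columns
  obtain ⟨l₁, l₂, l₃, h12, h13, h23, h1j, h2j, h3j⟩ :
      ∃ l₁ l₂ l₃ : Fin 4, l₁ ≠ l₂ ∧ l₁ ≠ l₃ ∧ l₂ ≠ l₃ ∧ l₁ ≠ j ∧ l₂ ≠ j ∧ l₃ ≠ j := by
    have key : ∀ j : Fin 4, ∃ l₁ l₂ l₃ : Fin 4, l₁ ≠ l₂ ∧ l₁ ≠ l₃ ∧ l₂ ≠ l₃ ∧ l₁ ≠ j ∧ l₂ ≠ j ∧
        l₃ ≠ j := by decide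
    exact key j
  rcases hfactor p hpq j l₁ l₂ h1j.symm h2j.symm h12 with hl₁ | hl₂ | hpj
  · rcases hfactor p hpq j l₂ l₃ h2j.symm h3j.symm h23 with hl₂ | hl₃ | hpj
    · exact (hone l₁ l₂ h12 hl₁ hl₂).elim
    · exact (hone l₁ l₃ h13 hl₁ hl₃).elim
    · exact hpj x hx
  · rcases hfactor p hpq j l₁ l₃ h1j.symm h3j.symm h13 with hl₁ | hl₃ | hpj
    · exact (hone l₁ l₂ h12 hl₁ hl₂).elim
    · exact (hone l₂ l₃ h23 hl₂ hl₃).elim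
    · exact hpj x hx
  · exact hpj x hx

end Summit.ValiantsHypothesis.ValiantsHypothesis.Theorems.SymPencilPerFourPermOrthThree

end
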